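import Summits.ValiantsHypothesis.ValiantsHypothesis.Theorems.NewtonFramesTwoProductsFrameRungTwoBinomialRigidity

/-!
# Crux `TwoProducts` (stmt-5906), line `FrameRungTwo`: the open stub `stub_crossCancelCount` for BINOMIAL frames

Registered forward line `Cruxes/TwoProducts/Lines/FrameRungTwo.lean` (rung `FrameRungTwo`: `k` products of `m`
bivariate polynomials drawn from TWO dissociated frames have `≤ (m t + 2)^{C(k)}` Newton vertices) stands modulo
its one OPEN stub `stub_crossCancelCount` (stubs `stub_classHull` p579112 and `stub_faceCount` p580655 landed): the
count of CROSS-CANCELLING vertices — vertices `p` of `Newt(Σ_i Π_j f i j)` strictly exposed by a functional under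
which a point of `supp F₀ ∪ supp F₁` lies strictly above `p`.  This file proves that stub in the binomial regime,
uniformly in `m`, BY THE LINE'S OWN METHOD (top tuples of a direct frame, one demoted letter):

* `crossCancel_binomial` — ONE product on each frame, every letter set of size `≤ t ≤ 2` (binomial factors): the
  cross-cancelling vertices of `Newt(Π_j f_j + Π_j g_j)` number `≤ (m t + 2)^5`;
* `crossCancelCount_le_two` — the stub's statement VERBATIM restricted to `k ≤ 2` and `t ≤ 2` (`C = 5`).

Calibration, honestly: as a NUMBER this bound is not new — for two products of binomials the tree's
`TwoProducts.Reduction.twoProducts_sparsity_le_two` already bounds ALL vertices of `Newt(Π f − Π g)` by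
`72 (m+1)²` for arbitrary (not necessarily dissociated) supports.  What is new is the STRUCTURE behind the count
on two dissociated frames (`…BinomialRigidity.lean`): at a cross-cancelling vertex the two frames have a common
top word sum, every one-letter demotion of either frame above the vertex is a one-letter demotion of the other
(same gap, same coefficient ratio — `matched_of_small`), and the vertex word demotes at most ONE letter of its
top tuple (`card_filter_le_one`) — the two-frame analogue, at thickness `1`, of the floor's annihilator/thickness
step, counted by the floor's landed `stub_topTupleCount` (`≤ 4 (m t)² + 7` top tuples per frame) times the
`m t + 1` single demotions (`count_arith 1`).  This is the mechanism the line needs beyond binomials; for `t = 3`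
it breaks exactly at in-coordinate carries (a gap of one frame equal to the sum of the two gaps of ONE coordinate
of the same frame, regrouped by the other frame: `{0,1,2}⊕{0,3,6}` vs `{0,1,6}⊕{0,2,4}` agree below `7 = 1+6`),
which is the stub's open content at `k = 2`; general `k` needs in addition the floor's alive boxes on both
frames.  Honest scope: a `t`-variant of one stub of a rung strictly below the crux `TwoProducts`; closing it does
not close the rung, the crux, or anything about `VP ≠ VNP`. [ours; setting KPTT arXiv:1308.2286 §2, §5]
-/

set_option linter.dupNamespace false

namespace Summit.ValiantsHypothesis.ValiantsHypothesis.Theorems.NewtonFramesTwoProducts.FrameRungTwoBinomial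

open MvPolynomial
open scoped BigOperators Classical
open Summit.ValiantsHypothesis.Theorems.DissociatedFixedK (lexKey lexKey_injective lexTop lexTop_mem lexKey_le_lexTop
  eq_lexTop_of_forall_le stub_topTupleCount count_arith coeff_sum_prod_of_dissociated exists_word_of_mem_support)
open Summit.ValiantsHypothesis.ValiantsHypothesis.Theorems.DissociatedFixedK.Negative (emb emb_injective)

noncomputable section

/-! ## Counting: the cross-cancelling vertices of `Π f + Π g` for two dissociated binomial frames

The covering finset of frame `f`: for every tuple `b ∈ Π_j supp (f j)` that is coordinatewise key-maximal for
SOME functional (the floor's `stub_topTupleCount` counts these: `≤ 4 (m t)² + 7`) and every optional single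
(coordinate, letter) pair `o` (`≤ m t + 1` of them), the point `emb (Σ_j b[o] j)` where `b[o]` is `b` with that
one letter overwritten.  Written inline (no new definition). -/

section Count

variable {m : ℕ}

/-- A word demoting at most one letter of a key-top tuple lies in the covering finset of its frame. -/
theorem mem_cover (l : (Fin 2 → ℝ) →L[ℝ] ℝ) (f : Fin m → MvPolynomial (Fin 2) ℂ) (T : Fin m → (Fin 2 →₀ ℕ))
    (hT : ∀ j, T j ∈ (f j).support) (hTmax : ∀ j, ∀ x ∈ (f j).support, lexKey l x ≤ lexKey l (T j))
    (a : Fin m → (Fin 2 →₀ ℕ)) (ha : ∀ j, a j ∈ (f j).support)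
    (hcard : (Finset.univ.filter fun i => a i ≠ T i).card ≤ 1) :
    emb (∑ j, a j) ∈ ((Fintype.piFinset fun j => (f j).support).filter fun b =>
        ∃ l : (Fin 2 → ℝ) →L[ℝ] ℝ, ∀ j, ∀ x ∈ (f j).support, lexKey l x ≤ lexKey l (b j)).biUnion fun b =>
      (Finset.insertNone (Finset.univ.biUnion fun j => ((f j).support).image (Prod.mk j))).image fun o =>
        emb (∑ j, Option.elim o b (fun p => Function.update b p.1 p.2) j) := by
  have hb : T ∈ (Fintype.piFinset fun j => (f j).support).filter fun b =>
      ∃ l : (Fin 2 → ℝ) →L[ℝ] ℝ, ∀ j, ∀ x ∈ (f j).support, lexKey l x ≤ lexKey l (b j) :=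
    Finset.mem_filter.2 ⟨Fintype.mem_piFinset.2 hT, l, hTmax⟩
  refine Finset.mem_biUnion.2 ⟨T, hb, ?_⟩
  rcases Nat.le_one_iff_eq_zero_or_eq_one.1 hcard with h0 | h1
  · -- no demoted letter: `a = T`
    have haT : a = T := funext fun i =>
      eq_T_of_not_mem_filter T (by rw [Finset.card_eq_zero.1 h0]; exact Finset.notMem_empty i)
    refine Finset.mem_image.2 ⟨none, Finset.none_mem_insertNone, ?_⟩
    simp [haT]
  · -- one demoted letter `j`: `a = T[j ↦ a j]`
    obtain ⟨j, hj⟩ := Finset.card_eq_one.1 h1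
    have haT : a = Function.update T j (a j) := by
      funext i
      rcases eq_or_ne i j with rfl | hne
      · rw [Function.update_self]
      · rw [Function.update_of_ne hne]
        exact eq_T_of_not_mem_filter T (by rw [hj, Finset.mem_singleton]; exact hne)
    refine Finset.mem_image.2 ⟨some (j, a j), ?_, ?_⟩
    · rw [Finset.some_mem_insertNone]
      exact Finset.mem_biUnion.2 ⟨j, Finset.mem_univ _, Finset.mem_image.2 ⟨a j, ha j, rfl⟩⟩
    · simp only [Option.elim]
      rw [← haT]

/-- The covering finset of a frame with letter sets of size `≤ t` has `≤ (m t + 1)(4 (m t)² + 7)` elements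
(the floor's `stub_topTupleCount` times the number of optional single demotions). -/
theorem card_cover_le (t : ℕ) (f : Fin m → MvPolynomial (Fin 2) ℂ) (hS : ∀ j, ((f j).support).card ≤ t) :
    (((Fintype.piFinset fun j => (f j).support).filter fun b =>
        ∃ l : (Fin 2 → ℝ) →L[ℝ] ℝ, ∀ j, ∀ x ∈ (f j).support, lexKey l x ≤ lexKey l (b j)).biUnion fun b =>
      (Finset.insertNone (Finset.univ.biUnion fun j => ((f j).support).image (Prod.mk j))).image fun o =>
        emb (∑ j, Option.elim o b (fun p => Function.update b p.1 p.2) j)).card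
      ≤ (m * t + 1) * (4 * (m * t) ^ 2 + 7) := by
  have hBT : ((Fintype.piFinset fun j => (f j).support).filter fun b =>
      ∃ l : (Fin 2 → ℝ) →L[ℝ] ℝ, ∀ j, ∀ x ∈ (f j).support, lexKey l x ≤ lexKey l (b j)).card
      ≤ 4 * (m * t) ^ 2 + 7 :=
    stub_topTupleCount m t (fun j => (f j).support) hS
  have hLET : (Finset.univ.biUnion fun j => ((f j).support).image (Prod.mk j)).card ≤ m * t := by
    calc (Finset.univ.biUnion fun j => ((f j).support).image (Prod.mk j)).card
        ≤ ∑ j, (((f j).support).image (Prod.mk j)).card := Finset.card_biUnion_le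
      _ ≤ ∑ _j : Fin m, t := Finset.sum_le_sum fun j _ => Finset.card_image_le.trans (hS j)
      _ = m * t := by simp
  calc _ ≤ ∑ b ∈ ((Fintype.piFinset fun j => (f j).support).filter fun b =>
          ∃ l : (Fin 2 → ℝ) →L[ℝ] ℝ, ∀ j, ∀ x ∈ (f j).support, lexKey l x ≤ lexKey l (b j)),
          ((Finset.insertNone (Finset.univ.biUnion fun j => ((f j).support).image (Prod.mk j))).image fun o =>
            emb (∑ j, Option.elim o b (fun p => Function.update b p.1 p.2) j)).card := Finset.card_biUnion_le
    _ ≤ ∑ _b ∈ ((Fintype.piFinset fun j => (f j).support).filter fun b =>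
          ∃ l : (Fin 2 → ℝ) →L[ℝ] ℝ, ∀ j, ∀ x ∈ (f j).support, lexKey l x ≤ lexKey l (b j)), (m * t + 1) := by
        refine Finset.sum_le_sum fun b _ => Finset.card_image_le.trans ?_
        rw [Finset.card_insertNone]
        exact Nat.add_le_add_right hLET 1
    _ = ((Fintype.piFinset fun j => (f j).support).filter fun b =>
          ∃ l : (Fin 2 → ℝ) →L[ℝ] ℝ, ∀ j, ∀ x ∈ (f j).support, lexKey l x ≤ lexKey l (b j)).card * (m * t + 1) := by
        rw [Finset.sum_const, smul_eq_mul]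
    _ ≤ (4 * (m * t) ^ 2 + 7) * (m * t + 1) := Nat.mul_le_mul_right _ hBT
    _ = (m * t + 1) * (4 * (m * t) ^ 2 + 7) := Nat.mul_comm _ _

/-- If one of the two classes vanishes there are no cross-cancelling vertices. -/
theorem cross_empty_of_union_subset (F F₀ F₁ : MvPolynomial (Fin 2) ℂ) (h : F₀.support ∪ F₁.support ⊆ F.support) :
    {p : Fin 2 → ℝ | p ∈ Set.extremePoints ℝ (convexHull ℝ (emb '' (F.support : Set (Fin 2 →₀ ℕ)))) ∧
        ∃ l : (Fin 2 → ℝ) →ₗ[ℝ] ℝ,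
          (∀ q ∈ emb '' (F.support : Set (Fin 2 →₀ ℕ)), q ≠ p → l q < l p) ∧
          ∃ q ∈ emb '' (F₀.support : Set (Fin 2 →₀ ℕ)) ∪ emb '' (F₁.support : Set (Fin 2 →₀ ℕ)),
            l p < l q} = ∅ := by
  ext p
  simp only [Set.mem_setOf_eq, Set.mem_empty_iff_false, iff_false, not_and]
  rintro - ⟨l, hl, q, hq, hlt⟩
  have hqF : q ∈ emb '' (F.support : Set (Fin 2 →₀ ℕ)) := by
    rcases hq with ⟨x, hx, rfl⟩ | ⟨x, hx, rfl⟩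
    · exact ⟨x, h (Finset.mem_union_left _ hx), rfl⟩
    · exact ⟨x, h (Finset.mem_union_right _ hx), rfl⟩
  exact absurd (hl q hqF (fun hqp => by rw [hqp] at hlt; exact lt_irrefl _ hlt)) (not_lt.2 hlt.le)

/-- **Cross-cancelling vertices for two dissociated binomial frames.**  One product on each frame, every letter
set of size `≤ t ≤ 2`: the vertices `p` of `Newt(Π_j f_j + Π_j g_j)` strictly exposed by a functional under
which some exponent of `Π f` or `Π g` lies strictly above `p` number at most `(m t + 2)^5`.
[ours; setting KPTT arXiv:1308.2286 §2] -/
theorem crossCancel_binomial (m t : ℕ) (ht : t ≤ 2) (A B : Fin m → Finset (Fin 2 →₀ ℕ))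
    (f g : Fin m → MvPolynomial (Fin 2) ℂ)
    (hA : ∀ j, (A j).card ≤ t) (hB : ∀ j, (B j).card ≤ t)
    (hf : ∀ j, (f j).support ⊆ A j) (hg : ∀ j, (g j).support ⊆ B j)
    (hinjA : ∀ a b : Fin m → (Fin 2 →₀ ℕ), (∀ j, a j ∈ A j) → (∀ j, b j ∈ A j) → ∑ j, a j = ∑ j, b j → a = b)
    (hinjB : ∀ a b : Fin m → (Fin 2 →₀ ℕ), (∀ j, a j ∈ B j) → (∀ j, b j ∈ B j) → ∑ j, a j = ∑ j, b j → a = b) :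
    {p : Fin 2 → ℝ | p ∈ Set.extremePoints ℝ (convexHull ℝ
          (emb '' ((∏ j, f j + ∏ j, g j).support : Set (Fin 2 →₀ ℕ)))) ∧
        ∃ l : (Fin 2 → ℝ) →ₗ[ℝ] ℝ,
          (∀ q ∈ emb '' ((∏ j, f j + ∏ j, g j).support : Set (Fin 2 →₀ ℕ)), q ≠ p → l q < l p) ∧
          ∃ q ∈ emb '' ((∏ j, f j).support : Set (Fin 2 →₀ ℕ)) ∪ emb '' ((∏ j, g j).support : Set (Fin 2 →₀ ℕ)),
            l p < l q}.ncard ≤ (m * t + 2) ^ 5 := by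
  have hfinal : 2 * ((m * t + 1) * (4 * (m * t) ^ 2 + 7)) ≤ (m * t + 2) ^ 5 := by
    have := count_arith 1 m t
    simpa [pow_one] using this
  by_cases h0 : (∀ j, f j ≠ 0) ∧ (∀ j, g j ≠ 0)
  swap
  · -- a zero factor: one class vanishes, no cross-cancelling vertex
    have hsub : (∏ j, f j).support ∪ (∏ j, g j).support ⊆ (∏ j, f j + ∏ j, g j).support := by
      rw [not_and_or] at h0
      rcases h0 with h | h
      · push Not at h
        obtain ⟨j, hj⟩ := h
        have hz : (∏ j, f j) = 0 := Finset.prod_eq_zero (Finset.mem_univ j) hj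
        rw [hz, support_zero, Finset.empty_union, zero_add]
      · push Not at h
        obtain ⟨j, hj⟩ := h
        have hz : (∏ j, g j) = 0 := Finset.prod_eq_zero (Finset.mem_univ j) hj
        rw [hz, support_zero, Finset.union_empty, add_zero]
    rw [cross_empty_of_union_subset _ _ _ hsub, Set.ncard_empty]
    exact Nat.zero_le _
  obtain ⟨hf0, hg0⟩ := h0
  have hnef : ∀ j, ((f j).support).Nonempty := fun j => by
    rw [Finset.nonempty_iff_ne_empty, Ne, MvPolynomial.support_eq_empty]; exact hf0 j
  have hneg : ∀ j, ((g j).support).Nonempty := fun j => by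
    rw [Finset.nonempty_iff_ne_empty, Ne, MvPolynomial.support_eq_empty]; exact hg0 j
  have h2f : ∀ j, ((f j).support).card ≤ 2 := fun j => ((Finset.card_le_card (hf j)).trans (hA j)).trans ht
  have h2g : ∀ j, ((g j).support).card ≤ 2 := fun j => ((Finset.card_le_card (hg j)).trans (hB j)).trans ht
  have hSf : ∀ j, ((f j).support).card ≤ t := fun j => (Finset.card_le_card (hf j)).trans (hA j)
  have hSg : ∀ j, ((g j).support).card ≤ t := fun j => (Finset.card_le_card (hg j)).trans (hB j)
  have hinjf : ∀ a b : Fin m → (Fin 2 →₀ ℕ), (∀ j, a j ∈ (f j).support) → (∀ j, b j ∈ (f j).support) →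
      ∑ j, a j = ∑ j, b j → a = b := fun a b ha hb => hinjA a b (fun j => hf j (ha j)) (fun j => hf j (hb j))
  have hinjg : ∀ a b : Fin m → (Fin 2 →₀ ℕ), (∀ j, a j ∈ (g j).support) → (∀ j, b j ∈ (g j).support) →
      ∑ j, a j = ∑ j, b j → a = b := fun a b ha hb => hinjB a b (fun j => hg j (ha j)) (fun j => hg j (hb j))
  -- the covering finset
  set Uf : Finset (Fin 2 → ℝ) := ((Fintype.piFinset fun j => (f j).support).filter fun b =>
        ∃ l : (Fin 2 → ℝ) →L[ℝ] ℝ, ∀ j, ∀ x ∈ (f j).support, lexKey l x ≤ lexKey l (b j)).biUnion fun b =>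
      (Finset.insertNone (Finset.univ.biUnion fun j => ((f j).support).image (Prod.mk j))).image fun o =>
        emb (∑ j, Option.elim o b (fun p => Function.update b p.1 p.2) j) with hUf
  set Ug : Finset (Fin 2 → ℝ) := ((Fintype.piFinset fun j => (g j).support).filter fun b =>
        ∃ l : (Fin 2 → ℝ) →L[ℝ] ℝ, ∀ j, ∀ x ∈ (g j).support, lexKey l x ≤ lexKey l (b j)).biUnion fun b =>
      (Finset.insertNone (Finset.univ.biUnion fun j => ((g j).support).image (Prod.mk j))).image fun o =>
        emb (∑ j, Option.elim o b (fun p => Function.update b p.1 p.2) j) with hUg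
  have hcover : {p : Fin 2 → ℝ | p ∈ Set.extremePoints ℝ (convexHull ℝ
          (emb '' ((∏ j, f j + ∏ j, g j).support : Set (Fin 2 →₀ ℕ)))) ∧
        ∃ l : (Fin 2 → ℝ) →ₗ[ℝ] ℝ,
          (∀ q ∈ emb '' ((∏ j, f j + ∏ j, g j).support : Set (Fin 2 →₀ ℕ)), q ≠ p → l q < l p) ∧
          ∃ q ∈ emb '' ((∏ j, f j).support : Set (Fin 2 →₀ ℕ)) ∪ emb '' ((∏ j, g j).support : Set (Fin 2 →₀ ℕ)),
            l p < l q} ⊆ ↑(Uf ∪ Ug) := by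
    rintro p ⟨hp, l, hl, q, hq, hlt⟩
    obtain ⟨e, he, rfl⟩ := extremePoints_convexHull_subset hp
    have he' : e ∈ (∏ j, f j + ∏ j, g j).support := he
    set lc : (Fin 2 → ℝ) →L[ℝ] ℝ := LinearMap.toContinuousLinearMap l with hlc
    have hlcl : ∀ v, lc v = l v := fun v => rfl
    obtain ⟨T, lo, -, hT, hlo, hTmax, hcov⟩ := exists_presentation lc f hnef h2f
    obtain ⟨T', lo', -, hT', hlo', hTmax', hcov'⟩ := exists_presentation lc g hneg h2g
    have hzero : ∀ x : Fin 2 →₀ ℕ, x ≠ e → lc (emb e) ≤ lc (emb x) →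
        coeff x (∏ j, f j) + coeff x (∏ j, g j) = 0 := by
      intro x hxe hle
      by_contra hne
      have hx : x ∈ (∏ j, f j + ∏ j, g j).support := by rw [mem_support_iff, coeff_add]; exact hne
      have h := hl (emb x) ⟨x, hx, rfl⟩ (fun h => hxe (emb_injective h))
      rw [hlcl, hlcl] at hle
      exact absurd h (not_lt.2 hle)
    have hzero' : ∀ x : Fin 2 →₀ ℕ, x ≠ e → lc (emb e) ≤ lc (emb x) →
        coeff x (∏ j, g j) + coeff x (∏ j, f j) = 0 := fun x hx hle => by rw [add_comm]; exact hzero x hx hle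
    have heF : coeff e (∏ j, f j) + coeff e (∏ j, g j) ≠ 0 := by
      rw [← coeff_add]; exact mem_support_iff.1 he'
    have heF' : coeff e (∏ j, g j) + coeff e (∏ j, f j) ≠ 0 := by rwa [add_comm]
    -- common top, from the point `q` on either side
    have htops : ∑ j, T j = ∑ j, T' j ∧ lexKey lc e < lexKey lc (∑ j, T j) := by
      rcases hq with ⟨x, hx, rfl⟩ | ⟨x, hx, rfl⟩
      · exact top_eq lc f g T T' hT hTmax hT' hTmax' hinjf hinjg e hzero ⟨x, hx, by rwa [hlcl, hlcl]⟩
      · have h := top_eq lc g f T' T hT' hTmax' hT hTmax hinjg hinjf e hzero' ⟨x, hx, by rwa [hlcl, hlcl]⟩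
        refine ⟨h.1.symm, ?_⟩
        rw [← h.1]; exact h.2
    obtain ⟨htop, hTe⟩ := htops
    have hTe' : lexKey lc e < lexKey lc (∑ j, T' j) := htop ▸ hTe
    rw [Finset.coe_union]
    rcases Finset.mem_union.1 (support_add he') with hef | heg
    · obtain ⟨a, ha, hae⟩ := exists_word f hinjf hef
      have hc := card_filter_le_one lc f g T lo T' lo' hT hlo hTmax hcov hT' hlo' hTmax' hcov' hinjf hinjg e
        hzero htop hTe ha hae heF
      rw [← hae]
      exact Set.mem_union_left _ (mem_cover lc f T hT hTmax a ha hc)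
    · obtain ⟨a, ha, hae⟩ := exists_word g hinjg heg
      have hc := card_filter_le_one lc g f T' lo' T lo hT' hlo' hTmax' hcov' hT hlo hTmax hcov hinjg hinjf e
        hzero' htop.symm hTe' ha hae heF'
      rw [← hae]
      exact Set.mem_union_right _ (mem_cover lc g T' hT' hTmax' a ha hc)
  calc _ ≤ (↑(Uf ∪ Ug) : Set (Fin 2 → ℝ)).ncard := Set.ncard_le_ncard hcover (Finset.finite_toSet _)
    _ = (Uf ∪ Ug).card := Set.ncard_coe_finset _
    _ ≤ Uf.card + Ug.card := Finset.card_union_le _ _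
    _ ≤ (m * t + 1) * (4 * (m * t) ^ 2 + 7) + (m * t + 1) * (4 * (m * t) ^ 2 + 7) :=
        Nat.add_le_add (card_cover_le t f hSf) (card_cover_le t g hSg)
    _ = 2 * ((m * t + 1) * (4 * (m * t) ^ 2 + 7)) := by ring
    _ ≤ (m * t + 2) ^ 5 := hfinal

end Count

/-! ## The registered stub `stub_crossCancelCount` for `k ≤ 2` and `t ≤ 2` -/

section Stub

/-- Sub-sums of a `Fin 1`-indexed family have support inside the full sum's support. -/
theorem support_filter_sum_subset_one {P : Fin 1 → Prop} [DecidablePred P] (g : Fin 1 → MvPolynomial (Fin 2) ℂ) :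
    (∑ i ∈ Finset.univ.filter P, g i).support ⊆ (∑ i, g i).support := by
  by_cases h : P 0
  · have : Finset.univ.filter P = Finset.univ := by
      ext i; simp only [Finset.mem_filter, Finset.mem_univ, true_and, iff_true]
      rwa [Subsingleton.elim i 0]
    rw [this]
  · have : Finset.univ.filter P = ∅ := by
      ext i; simp only [Finset.mem_filter, Finset.mem_univ, true_and, Finset.notMem_empty, iff_false]
      rwa [Subsingleton.elim i 0]
    rw [this, Finset.sum_empty, support_zero]
    exact Finset.empty_subset _

/-- **`stub_crossCancelCount` for `k ≤ 2` and binomial frames (`t ≤ 2`)**, with `C = 5`: the registered stub of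
line `FrameRungTwo` (crux `TwoProducts`, stmt-5906) restricted to at most two products and letter sets of size at
most two — its statement otherwise verbatim (two dissociated frames `A 0, A 1`, products assigned by `c`).  With
both products on one frame, or fewer than two products, one class is empty and there is no cross-cancelling
vertex; with one product on each frame this is `crossCancel_binomial`. [ours; setting KPTT arXiv:1308.2286 §2] -/
theorem crossCancelCount_le_two : ∀ k ≤ 2, ∃ C : ℕ, ∀ (m t : ℕ), t ≤ 2 →
    ∀ (A : Fin 2 → Fin m → Finset (Fin 2 →₀ ℕ)) (c : Fin k → Fin 2) (f : Fin k → Fin m → MvPolynomial (Fin 2) ℂ),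
    (∀ σ j, (A σ j).card ≤ t) →
    (∀ i j, (f i j).support ⊆ A (c i) j) →
    (∀ σ, ∀ a b : Fin m → (Fin 2 →₀ ℕ), (∀ j, a j ∈ A σ j) → (∀ j, b j ∈ A σ j) →
        ∑ j, a j = ∑ j, b j → a = b) →
    {p : Fin 2 → ℝ | p ∈ Set.extremePoints ℝ (convexHull ℝ (emb ''
          ((∑ i, ∏ j, f i j).support : Set (Fin 2 →₀ ℕ)))) ∧
        ∃ l : (Fin 2 → ℝ) →ₗ[ℝ] ℝ,
          (∀ q ∈ emb '' ((∑ i, ∏ j, f i j).support : Set (Fin 2 →₀ ℕ)), q ≠ p → l q < l p) ∧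
          ∃ q ∈ emb '' ((∑ i ∈ Finset.univ.filter (fun i => c i = 0), ∏ j, f i j).support
                          : Set (Fin 2 →₀ ℕ)) ∪
                 emb '' ((∑ i ∈ Finset.univ.filter (fun i => c i = 1), ∏ j, f i j).support
                          : Set (Fin 2 →₀ ℕ)),
            l p < l q}.ncard ≤ (m * t + 2) ^ C := by
  intro k hk
  refine ⟨5, ?_⟩
  intro m t ht A c f hA hf hinj
  interval_cases k
  · -- no product at all
    rw [cross_empty_of_union_subset _ _ _ (by simp), Set.ncard_empty]
    exact Nat.zero_le _
  · -- one product: one class is the whole sum, the other is empty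
    rw [cross_empty_of_union_subset _ _ _ (Finset.union_subset (support_filter_sum_subset_one _)
      (support_filter_sum_subset_one _)), Set.ncard_empty]
    exact Nat.zero_le _
  · -- two products
    by_cases hc : c 0 = c 1
    · -- both on one frame: one class is everything
      have hsub : ∀ σ : Fin 2, (∑ i ∈ Finset.univ.filter (fun i => c i = σ), ∏ j, f i j).support ⊆
          (∑ i, ∏ j, f i j).support := by
        intro σ
        by_cases h : c 0 = σ
        · have : Finset.univ.filter (fun i => c i = σ) = Finset.univ := by
            ext i; fin_cases i <;> simp [h, ← hc]
          rw [this]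
        · have : Finset.univ.filter (fun i => c i = σ) = ∅ := by
            ext i; fin_cases i <;> simp [h, ← hc]
          rw [this, Finset.sum_empty, support_zero]
          exact Finset.empty_subset _
      rw [cross_empty_of_union_subset _ _ _ (Finset.union_subset (hsub 0) (hsub 1)), Set.ncard_empty]
      exact Nat.zero_le _
    · -- one product on each frame
      have hsum : (∑ i, ∏ j, f i j) = ∏ j, f 0 j + ∏ j, f 1 j := Fin.sum_univ_two _
      have key : ∀ x : Fin 2, x = 0 ∨ x = 1 := by decide
      rcases key (c 0) with h0 | h0 <;> rcases key (c 1) with h1 | h1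
      · exact absurd (h0.trans h1.symm) hc
      · have e0 : (∑ i ∈ Finset.univ.filter (fun i => c i = 0), ∏ j, f i j) = ∏ j, f 0 j := by
          have : Finset.univ.filter (fun i => c i = 0) = {0} := by ext i; fin_cases i <;> simp [h0, h1]
          rw [this, Finset.sum_singleton]
        have e1 : (∑ i ∈ Finset.univ.filter (fun i => c i = 1), ∏ j, f i j) = ∏ j, f 1 j := by
          have : Finset.univ.filter (fun i => c i = 1) = {1} := by ext i; fin_cases i <;> simp [h0, h1]
          rw [this, Finset.sum_singleton]
        rw [hsum, e0, e1]
        exact crossCancel_binomial m t ht (A 0) (A 1) (f 0) (f 1) (hA 0) (hA 1)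
          (fun j => by have := hf 0 j; rwa [h0] at this) (fun j => by have := hf 1 j; rwa [h1] at this)
          (hinj 0) (hinj 1)
      · have e0 : (∑ i ∈ Finset.univ.filter (fun i => c i = 0), ∏ j, f i j) = ∏ j, f 1 j := by
          have : Finset.univ.filter (fun i => c i = 0) = {1} := by ext i; fin_cases i <;> simp [h0, h1]
          rw [this, Finset.sum_singleton]
        have e1 : (∑ i ∈ Finset.univ.filter (fun i => c i = 1), ∏ j, f i j) = ∏ j, f 0 j := by
          have : Finset.univ.filter (fun i => c i = 1) = {0} := by ext i; fin_cases i <;> simp [h0, h1]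
          rw [this, Finset.sum_singleton]
        rw [hsum, e0, e1, add_comm]
        exact crossCancel_binomial m t ht (A 0) (A 1) (f 1) (f 0) (hA 0) (hA 1)
          (fun j => by have := hf 1 j; rwa [h1] at this) (fun j => by have := hf 0 j; rwa [h0] at this)
          (hinj 0) (hinj 1)
      · exact absurd (h0.trans h1.symm) hc

end Stub

end

end Summit.ValiantsHypothesis.ValiantsHypothesis.Theorems.NewtonFramesTwoProducts.FrameRungTwoBinomial
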